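import Summits.NavierStokesRegularity.NavierStokesRegularity.Theorems.ExtremiserTransienceNearExtremalTransienceExtremiserLiouvilleConstantSpeedSlideEnstrophy
import HarnessLib

/-!
# Crux `ExtremiserTransience.NearExtremalTransience` (stmt-NavierStokesRegularity-21883), line `extremiser_liouville`,
# stub K1b — THE CURL OF THE SLIDE GENERATOR as a vector identity (input of the Z′-line, blueprint L4)

`--supports stmt-NavierStokesRegularity-21883` (helper).  Author: prover seat `ns-el-k1b` (g8).  Record:
`Cruxes/NearExtremalTransience/Lines/extremiser_liouville_k1b_slide.md` §2, §11 (L4).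

`…SlideEnstrophy.inner_curl_slideGenerator` gives `⟪ω, curl φ_g⟫`; the palinstrophy variation `c₁(φ_g) = ∫⟪Dω, D curl φ_g⟫`
(the `Z′`-line of (INEQ)) needs `curl φ_g` ITSELF, to be differentiated once more:
* `curl_slideGenerator_eq` : **`curl(g(x₂)∂₂V + g′(x₂)V_h)(x) = g(x₂)·curl(∂₂V)(x) + g′(x₂)·A(x) + g″(x₂)·B(x)`** with
  `A = (−2P₁, 2P₀, ω₂)`, `B = (−V₁, V₀, 0)`, `P = ∂₂V`, `ω = curl V` (each written on the standard basis).
With `curl ∂₂V = ∂₂ω` (`curl_fderiv_apply_comm`) the exactly verified pointwise formula of record §11,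
`⟪Dω, D curl φ_g⟫_F = g·½∂₂|Dω|²_F + g′[|∂₂ω|² + ⟪Dω,DA⟫_F] + g″[⟪∂₂ω,A⟫ + ⟪Dω,DB⟫_F] + g‴⟪∂₂ω,B⟫`, follows by one more
product rule (next seat; only `D²V` appears after the discrete product rule `…DiscreteProductRule` replaces `g·½∂₂|Dω|²_F`).

WHAT THIS IS NOT: K1b is NOT proved; nothing here proves NS regularity. [folklore]
-/

noncomputable section

open Set Filter Topology MeasureTheory Metric Function InnerProductSpace
open scoped ENNReal NNReal Topology InnerProductSpace RealInnerProductSpace ContDiff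
open Literature.Analysis.FluidPDE Literature.Analysis

namespace Summit.NavierStokesRegularity.NavierStokesRegularity.Theorems

-- the problem directory repeats the summit name (`NavierStokesRegularity/NavierStokesRegularity`)
set_option linter.dupNamespace false

namespace ExtremiserLiouville

open DepletionLadder.KStar

variable {V : EuclideanSpace ℝ (Fin 3) → EuclideanSpace ℝ (Fin 3)} {g : ℝ → ℝ}

/-- **The curl of the slide generator**: `curl φ_g = g·curl ∂₂V + g′·(−2P₁, 2P₀, ω₂) + g″·(−V₁, V₀, 0)` (`P = ∂₂V`).
[folklore] -/
theorem curl_slideGenerator_eq (hV : ContDiff ℝ 2 V) (hg : ContDiff ℝ 2 g) (x : EuclideanSpace ℝ (Fin 3)) :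
    curl (fun y : EuclideanSpace ℝ (Fin 3) =>
        g (y 2) • fderiv ℝ V y (EuclideanSpace.single (2 : Fin 3) (1 : ℝ)) +
          deriv g (y 2) • (V y - (V y 2) • EuclideanSpace.single (2 : Fin 3) (1 : ℝ))) x =
      g (x 2) • curl (fun y => fderiv ℝ V y (EuclideanSpace.single (2 : Fin 3) (1 : ℝ))) x +
        deriv g (x 2) • ((-2 * fderiv ℝ V x (EuclideanSpace.single 2 1) 1) • EuclideanSpace.single (0 : Fin 3) (1 : ℝ) +
          (2 * fderiv ℝ V x (EuclideanSpace.single 2 1) 0) • EuclideanSpace.single (1 : Fin 3) (1 : ℝ) +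
          (curl V x 2) • EuclideanSpace.single (2 : Fin 3) (1 : ℝ)) +
        deriv (deriv g) (x 2) • ((-V x 1) • EuclideanSpace.single (0 : Fin 3) (1 : ℝ) +
          (V x 0) • EuclideanSpace.single (1 : Fin 3) (1 : ℝ)) := by
  set e₂ : EuclideanSpace ℝ (Fin 3) := EuclideanSpace.single (2 : Fin 3) (1 : ℝ) with he₂
  have hVd : Differentiable ℝ V := hV.differentiable two_ne_zero
  have hgd : Differentiable ℝ g := hg.differentiable two_ne_zero
  have hg'c : ContDiff ℝ 1 (deriv g) := by
    have h2 : ContDiff ℝ (1 + 1) g := by rw [show ((1 : WithTop ℕ∞) + 1) = 2 by norm_num]; exact hg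
    exact h2.deriv'
  have hg'd : Differentiable ℝ (deriv g) := hg'c.differentiable one_ne_zero
  set a : EuclideanSpace ℝ (Fin 3) → ℝ := fun y => g (y 2) with ha
  set b : EuclideanSpace ℝ (Fin 3) → ℝ := fun y => deriv g (y 2) with hb
  set Pf : EuclideanSpace ℝ (Fin 3) → EuclideanSpace ℝ (Fin 3) := fun y => fderiv ℝ V y e₂ with hPf
  set W : EuclideanSpace ℝ (Fin 3) → EuclideanSpace ℝ (Fin 3) := fun y => V y - (V y 2) • e₂ with hW
  have haD : HasFDerivAt a (deriv g (x 2) • (EuclideanSpace.proj (2 : Fin 3) : EuclideanSpace ℝ (Fin 3) →L[ℝ] ℝ)) x :=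
    hasFDerivAt_comp_coord hgd 2 x
  have hbD : HasFDerivAt b (deriv (deriv g) (x 2) • (EuclideanSpace.proj (2 : Fin 3) : EuclideanSpace ℝ (Fin 3) →L[ℝ] ℝ)) x :=
    hasFDerivAt_comp_coord hg'd 2 x
  have hPd : Differentiable ℝ Pf :=
    ((hV.fderiv_right (m := 1) (by norm_num)).differentiable one_ne_zero).clm_apply (differentiable_const e₂)
  have hPD : HasFDerivAt Pf (fderiv ℝ Pf x) x := (hPd x).hasFDerivAt
  have hV2 : HasFDerivAt (fun z => V z 2)
      ((EuclideanSpace.proj (2 : Fin 3) : EuclideanSpace ℝ (Fin 3) →L[ℝ] ℝ).comp (fderiv ℝ V x)) x :=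
    (EuclideanSpace.proj (2 : Fin 3) : EuclideanSpace ℝ (Fin 3) →L[ℝ] ℝ).hasFDerivAt.comp x (hVd x).hasFDerivAt
  have hWD : HasFDerivAt W (fderiv ℝ V x -
      (((EuclideanSpace.proj (2 : Fin 3) : EuclideanSpace ℝ (Fin 3) →L[ℝ] ℝ).comp (fderiv ℝ V x)).smulRight e₂)) x := by
    have h1 : HasFDerivAt (fun z => (V z 2) • e₂)
        ((((EuclideanSpace.proj (2 : Fin 3) : EuclideanSpace ℝ (Fin 3) →L[ℝ] ℝ).comp (fderiv ℝ V x)).smulRight e₂)) x :=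
      hV2.smul_const e₂
    exact (hVd x).hasFDerivAt.sub h1
  have h1 : HasFDerivAt (fun y => a y • Pf y)
      (a x • fderiv ℝ Pf x + (deriv g (x 2) • (EuclideanSpace.proj (2 : Fin 3) : EuclideanSpace ℝ (Fin 3) →L[ℝ] ℝ)).smulRight (Pf x)) x :=
    haD.smul hPD
  have h2 : HasFDerivAt (fun y => b y • W y)
      (b x • (fderiv ℝ V x -
        (((EuclideanSpace.proj (2 : Fin 3) : EuclideanSpace ℝ (Fin 3) →L[ℝ] ℝ).comp (fderiv ℝ V x)).smulRight e₂)) +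
        (deriv (deriv g) (x 2) • (EuclideanSpace.proj (2 : Fin 3) : EuclideanSpace ℝ (Fin 3) →L[ℝ] ℝ)).smulRight (W x)) x :=
    hbD.smul hWD
  have hφ : HasFDerivAt (fun y => a y • Pf y + b y • W y)
      ((a x • fderiv ℝ Pf x + (deriv g (x 2) • (EuclideanSpace.proj (2 : Fin 3) : EuclideanSpace ℝ (Fin 3) →L[ℝ] ℝ)).smulRight (Pf x)) +
        (b x • (fderiv ℝ V x -
          (((EuclideanSpace.proj (2 : Fin 3) : EuclideanSpace ℝ (Fin 3) →L[ℝ] ℝ).comp (fderiv ℝ V x)).smulRight e₂)) +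
          (deriv (deriv g) (x 2) • (EuclideanSpace.proj (2 : Fin 3) : EuclideanSpace ℝ (Fin 3) →L[ℝ] ℝ)).smulRight (W x))) x :=
    h1.add h2
  have hfun : (fun y : EuclideanSpace ℝ (Fin 3) => g (y 2) • fderiv ℝ V y e₂ + deriv g (y 2) • (V y - (V y 2) • e₂)) =
      fun y => a y • Pf y + b y • W y := rfl
  rw [hfun]
  have hDφ := hφ.fderiv
  ext i
  fin_cases i <;>
  · simp only [curl]
    rw [hDφ]
    simp [ha, hb, hW, he₂]
    ring

end ExtremiserLiouville

end Summit.NavierStokesRegularity.NavierStokesRegularity.Theorems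

end
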